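import Mathlib.LinearAlgebra.Matrix.Hermitian
import Mathlib.Analysis.Complex.Basic
import Mathlib.Data.Nat.Dist
import HarnessLib

/-!
# Localizing large matrices (Lieb–Solovej)

The localisation theorem for Hermitian matrices of E. H. Lieb and J. P. Solovej, *Ground state
energy of the one-component charged Bose gas*, Commun. Math. Phys. 217 (2001) 127–163
[LiebSolovej2001, Appendix, "Localization of large matrices" (arXiv:cond-mat/0007425 Thm. 10.1)],
reprinted as Theorem 10.6 ("Localizing large matrices"), eq. (10.8), of E. H. Lieb, R. Seiringer,
J. P. Solovej, J. Yngvason, *The Mathematics of the Bose Gas and its Condensation* (2005)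
[LSSY2005, Thm. 10.6 (10.8), book p. 105]. Verbatim (arXiv Thm. 10.1, `N × N` indexing):

> Suppose that `𝒜` is an `N × N` Hermitean matrix and let `𝒜^k`, with `k = 0, 1, …, N-1`, denote
> the matrix consisting of the `k`-th supra- and infra-diagonal of `𝒜`. Let `ψ ∈ ℂ^N` be a
> normalized vector and set `d_k = (ψ, 𝒜^k ψ)` and `λ = (ψ, 𝒜ψ) = ∑_{k=0}^{N-1} d_k`. (`ψ` need not
> be an eigenvector of `𝒜`.) Choose some positive integer `M ≤ N`. Then, with `M` fixed, there is
> some `n ∈ [0, N-M]` and some normalized vector `φ ∈ ℂ^N` with the property that `φ_j = 0` unless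
> `n+1 ≤ j ≤ n+M` (i.e., `φ` has length `M`) and such that
> `(φ, 𝒜φ) ≤ λ + (C/M²) ∑_{k=1}^{M-1} k² |d_k| + C ∑_{k=M}^{N-1} |d_k|`,          (10.8)
> where `C > 0` is a universal constant. (Note that the first sum starts with `k = 1`.)

(The book states the same for an `(N+1) × (N+1)` matrix, `k = 0, …, N`, `M ≤ N+1`.) This is the
"`1/M²` law" by which an approximate ground state may be restricted to a window of `M`
consecutive eigenvalues of a number operator at a cost controlled by the off-diagonal
expectations `d_1, d_2` (LSSY 2005 §10.4.3; used for BEC/number localisation arguments, e.g. the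
number-filter mechanism of route BECJosephsonSlackThreshold — this fact grounds
`Summit.AtomisticToContinuum.BoseEinsteinCondensation.Theses.BECJosephsonSlackThreshold.FilterFragmentation`
as its printed matrix prototype; the route item itself is a configuration-space statement and is
NOT this theorem).

## Rendering

* Indices are `Fin N` (0-based): "`φ_j = 0` unless `n+1 ≤ j ≤ n+M`" becomes `φ j = 0` whenever
  `j < n` or `n + M ≤ j`, with `n + M ≤ N`.
* `bandPart A k = 𝒜^k` keeps the entries `A i j` with `|i - j| = k` (`Nat.dist`) and zeroes the
  rest; `𝒜⁰` is the diagonal part.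
* `(ψ, 𝒜ψ)` is the sesquilinear form `star ψ ⬝ᵥ (A *ᵥ ψ) ∈ ℂ` (`quadForm`); for Hermitian `A` and
  Hermitian `𝒜^k` these are real, and the inequality (10.8) is stated between real parts, with
  `|d_k|` the complex norm — for real `d_k` this is literally (10.8).
* "normalized" is `star ψ ⬝ᵥ ψ = 1`. The universal constant is the outermost `∃ C > 0`.

Vendored as a NAMED FACT (`def LSSY2005_thm10_6 : Prop`; D-0014: users take
`(h : LSSY2005_thm10_6)`); the three-page proof (a Fejér-type window `f(s) = A_M[M+1-2|s|]` and an
averaging argument) is not formalised here. Mathlib has Hermitian matrices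
(`Matrix.IsHermitian`), `dotProduct`, `mulVec`; it has no band decomposition or this theorem
(`lean search "supra"`, `"infra-diagonal"`, `"Localiz.*matri"`: no hits).
-/

namespace Literature.LinearAlgebra.BandMatrix

open scoped Matrix

/-- The `k`-th **supra- and infra-diagonal part** `𝒜^k` of a square matrix `A`: the entries
`A i j` with `|i - j| = k`, all other entries `0` (so `𝒜⁰` is the diagonal part and
`A = ∑_{k=0}^{N-1} 𝒜^k`). [cite: LSSY2005, Thm. 10.6] -/
def bandPart {N : ℕ} (A : Matrix (Fin N) (Fin N) ℂ) (k : ℕ) : Matrix (Fin N) (Fin N) ℂ :=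
  Matrix.of fun i j => if (i : ℕ).dist j = k then A i j else 0

/-- The sesquilinear expectation `(ψ, Aψ) = ∑_{i,j} conj(ψ_i) A_{ij} ψ_j ∈ ℂ` of a square matrix in
a vector (real when `A` is Hermitian). [cite: LSSY2005, Thm. 10.6] -/
def quadForm {N : ℕ} (A : Matrix (Fin N) (Fin N) ℂ) (ψ : Fin N → ℂ) : ℂ :=
  star ψ ⬝ᵥ (A *ᵥ ψ)

/-- Entries of the band part. [cite: LSSY2005, Thm. 10.6] -/
theorem bandPart_apply {N : ℕ} (A : Matrix (Fin N) (Fin N) ℂ) (k : ℕ) (i j : Fin N) :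
    bandPart A k i j = if (i : ℕ).dist j = k then A i j else 0 := rfl

/-- The band parts of a Hermitian matrix are Hermitian (`|i - j| = |j - i|`).
[cite: LSSY2005, Thm. 10.6] -/
theorem isHermitian_bandPart {N : ℕ} {A : Matrix (Fin N) (Fin N) ℂ} (hA : A.IsHermitian) (k : ℕ) :
    (bandPart A k).IsHermitian := by
  refine Matrix.IsHermitian.ext fun i j => ?_
  simp only [bandPart, Matrix.of_apply, Nat.dist_comm (j : ℕ) i]
  split_ifs with h
  · exact hA.apply i j
  · simp

/-- The band parts sum to the matrix: `A = ∑_{k=0}^{N-1} 𝒜^k`. [cite: LSSY2005, Thm. 10.6] -/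
theorem sum_bandPart {N : ℕ} (A : Matrix (Fin N) (Fin N) ℂ) :
    ∑ k ∈ Finset.range N, bandPart A k = A := by
  ext i j
  have hlt : (i : ℕ).dist j < N := by
    rcases le_total (i : ℕ) j with h | h
    · rw [Nat.dist_eq_sub_of_le h]; omega
    · rw [Nat.dist_eq_sub_of_le_right h]; omega
  simp [Matrix.sum_apply, bandPart, Finset.mem_range, hlt]

/-- **Localizing large matrices** [LiebSolovej2001, Appendix Thm. (arXiv Thm. 10.1)] =
[LSSY2005, Thm. 10.6, (10.8)]: there is a universal constant `C > 0` such that for every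
`N × N` Hermitian matrix `𝒜`, every normalised `ψ ∈ ℂ^N` and every positive integer `M ≤ N`
there are `n ∈ [0, N-M]` and a normalised `φ ∈ ℂ^N` supported on the `M` consecutive indices
`n, …, n+M-1` (0-based) with
`(φ, 𝒜φ) ≤ (ψ, 𝒜ψ) + (C/M²) ∑_{k=1}^{M-1} k² |d_k| + C ∑_{k=M}^{N-1} |d_k|`, `d_k = (ψ, 𝒜^k ψ)`.
Grounds (as printed prototype, not as an instance)
`Summit.AtomisticToContinuum.BoseEinsteinCondensation.Theses.BECJosephsonSlackThreshold.FilterFragmentation`.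
[cite: LSSY2005, Thm. 10.6 (10.8)] -/
def LSSY2005_thm10_6 : Prop :=
  ∃ C : ℝ, 0 < C ∧ ∀ (N M : ℕ), 0 < M → M ≤ N →
    ∀ A : Matrix (Fin N) (Fin N) ℂ, A.IsHermitian →
    ∀ ψ : Fin N → ℂ, star ψ ⬝ᵥ ψ = 1 →
      ∃ n : ℕ, n + M ≤ N ∧ ∃ φ : Fin N → ℂ, star φ ⬝ᵥ φ = 1 ∧
        (∀ j : Fin N, ((j : ℕ) < n ∨ n + M ≤ (j : ℕ)) → φ j = 0) ∧
        (quadForm A φ).re ≤ (quadForm A ψ).re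
          + C / (M : ℝ) ^ 2 * ∑ k ∈ Finset.Ico 1 M, (k : ℝ) ^ 2 * ‖quadForm (bandPart A k) ψ‖
          + C * ∑ k ∈ Finset.Ico M N, ‖quadForm (bandPart A k) ψ‖

end Literature.LinearAlgebra.BandMatrix
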